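import Literature.MathematicalPhysics.QuantumFieldTheory.Balaban1983to89.B6BlockHolderCalculus
import Literature.MathematicalPhysics.QuantumFieldTheory.Balaban1983to89.B6BlockDecayGradFactorsV1

/-!
# `Balaban1983to89.B6HjOneLevelBridgeV1` — T. Bałaban, *Propagators and renormalization transformations for lattice gauge theories. II*,
# Commun. Math. Phys. **96** (1984) 223–250 [Balaban1984PropagatorsII], (2.130) p. 246: THE KERNEL BRIDGE between the two-scale minimizer `H_j`
# of the concrete Sect. C data `tsV1` and p09's Sect. 7.2 representation `H = GQ*(QGQ*)⁻¹` ([4] (1.103)) on `torusRep P j (deltaAData _ a)` —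
# and, through [BalabanImbrieJaffe1985] (7.2.2), THE HÖLDER (PAIR) BOUND OF `∇_λH_j` WITH A DECAY RATE INDEPENDENT OF `α`

statement-level skeleton of published theorems with citation tags; proofs where landed; nothing here is a claim about the Yang–Mills mass gap

PDF held: `paper:balaban1984-cmp96-propagators-rt-ii` (journal page = PDF page + 222; p. 246 = PDF 24, text layer `p0024.txt` L13–L19 and the ×2
render `pub-balaban/b2b-balaban-ref1/pages/1984-cmp96-propagators-rt-II/…-p024-x2.png`, read this seat 2026-08-22); `paper:balaban1984-cmp95-
propagators-rt-i` ([4]; journal page = PDF page + 16; p. 34 = PDF 18, `p0018.txt` L21–L24); `paper:balaban1985-cmp97-bij-higgs-minimizers`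
([BalabanImbrieJaffe1985]; journal page = PDF page + 298; p. 325 = PDF 27, `p0027.txt` L22–L25).

PRINT (verbatim, text layer / render).  [B6] p. 246: *"We have to investigate yet the operators G̃_j, H_j, and H′_j. Doing similar calculations as in
Sect. E. (1.91)–(1.103), in fact much simpler, we get the formula H_j = G_jQ_j*(Q_jG_jQ_j*)⁻¹. (2.130) Thus this operator coincides with the
operator introduced in Sect. D. … From these representations we obtain all the necessary properties of the operators H_j, G̃_j. They follow from
the Proposition 1.2 and from the formulas and the inequalities (1.99)–(1.101) for Q_jG_jQ_j*."* (READING NOTE: the next printed sentences — *"The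
operator H′_j can be investigated using the momentum representation obtained from (2.101) … derivatives of H′_j up to third order, and their local
Hölder norms as in (2.67), are uniformly bounded and have a uniform exponential decay with a decay rate depending on d only"* — concern `H′_j`, with a
prime, on the render; for `H_j` the printed route is Proposition 1.2 + (1.99)–(1.101), which is the route taken here.)  [4] p. 34: *"so finally we get
the representation H_kB = GQ*(QGQ*)⁻¹B. (1.103) This representation allows us to reduce a proof of properties of H_k to the corresponding properties
of G."*  [BalabanImbrieJaffe1985] p. 325: *"The kernel H_{k,μν}(x, y) and its gradient decay exponentially. In particular there exists δ > 0 and for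
0 ≤ α < 1 a constant M = M(α) < ∞ such that for |x − x′| ≤ 1, … (7.2.2) This inequality is a consequence of Proposition 1.2 and the representation
(1.103) of [6I]."*

CITATION HEADER (lean-in-tree rule) — WHAT IS REPRODUCED.  Phase-2 file of the `lit-balaban` typed skeleton (HOME `run/shared/lean/pub/lit-balaban/`),
seat **r03 gen 16** (B6 fold owner, own lane; TAKING 2026-08-22T15:54Z; referee ref-4), executing HOME/GAPS.md **G-B6-p38-01, UPGRADE PATH (a)**
(*"the printed route (2.130) H_j = G_jQ_j*(Q_jG_jQ_j*)⁻¹ with [4] (1.111)₁ for G_j (α-free rate) and (1.99)–(1.101) for (Q_jG_jQ_j*)⁻¹ — needs the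
kernel bridge (tsV1).Hj ↔ p09 `BIJ85Ineq722Proof.Rep103.H`"*).  SKELETON rows **B6.Prop2.5** / **B6.Eq2.130** (cells only; every decl of record
untouched: p22's `…B6SectCOperators.TwoScaleData.Hj` p255063 / `…B6SectCTwoScaleV1Lattice.tsV1`, p09's `…BIJ85Ineq722Proof.Rep103.H`/`gradH`,
p38's `…B6BlockHolderHjV1.holderBound_DHj`).  Inputs BY NAME, restating nothing: p22's weight freedom `…B6Repr2129Operator.Hj_eq_hOp_smul_V1`
(`H_j = G′Q_j*(Q_jG′Q_j*)⁻¹`, `G′ = (M_j + w′Q_j*Q_j)⁻¹`, every `w′ > 0`) and `QGaQ_comp_inverse`, p22's `…B6BlockDecayGtV1.inverse_MjQ_smul_apply`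
(`G′` = p21's whole-torus `GE` at weight `w′`), r03 g10's `…B6GOneLevelV1Bridge.GE_apply_eq_sum_Gk` (`GE` at `w′ = a·n^d`, `c = L^j` IS p09's kernel
`Gk` of [4]'s `Δ_a⁻¹`), p09's `…BIJ85Ineq722Torus.torusRep_std_Q_mulVec` (`Q_j` = the (1.18) kernel), p09's `Rep103.M_mul_K` (Combes–Thomas
invertibility of `QGQ*`) and (7.2.2) `…BIJ85Ineq722ProofPart2.abs_gradH_sub_le`, made hypothesis-free by p09's `hyps_torus`/`torusHyps_deltaA`
((1.100) for `Δ_a⁻¹`, [4] Prop. 1.1 symmetry, the (1.18) clauses), `cutoffHyps_torus` and p19's `…BIJ85Prop12AllTori.prop12Printed_allTori_allScales`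
([4] Proposition 1.2 for EVERY torus and scale, ONE `δ₀`, `O(1)`, `O(1)(α)`); p38's bookkeeping `…B6BlockHolderCalculus.holderBound_of_entry`.

WHAT IS PROVED (kernel-checked; THEOREMS ONLY — no `def`, no `def … : Prop`, nothing is a named unproved fact; standard axioms).  For the concrete
two-scale data `tsV1 hc Λ′ w` (`j + 1 ≤ m + K`, `Λ′ ⊂ T^{(j+1)}` ARBITRARY, weights `w > 0`) at the scaling `c = L^j`, any `a > 0`, `w′ = a·(L^j)^d`,
`R := torusRep P j (deltaAData _ a)`:
* §1 (private) bookkeeping on `ℓ²`: `apply_eq_sum_single` (`(fx)_i = Σ_k (fe_k)_i x_k`), `adjoint_single_apply` (`(f*e_i)_k = (fe_k)_i`).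
* §2 `Qv_apply_eq_sum` / `Qv_single_apply` (`Q_j` of `tsV1` IS p09's kernel `Q = η^d·QsStdᵀ`, any `c`), `adjQv_apply_eq_sum` (`Q_j* = η^d·QsStd` —
  `tsV1`'s `ℓ²`-adjoint is `η^d` times the print's `η^d`-weighted adjoint (1.21), a bookkeeping factor that cancels below).
* §3 `Gw_apply_eq_sum` (`G′ = Gk` entrywise), **`QGQ_single_apply`** (`Q_jG′Q_j* = η^d·M`, `M = QGQ*` of `R`), **`Ew_apply_eq_sum`**
  (`(Q_jG′Q_j*)⁻¹ = η^{−d}·K`, `K = M⁻¹`, via `K·M = 1`), **`Hj_single_apply_eq_H`: `H_j(e_q)_b = R.H((b₋, μ(b)); (q₋, ν(q)))` — (2.130) «this operator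
  coincides with the operator introduced in Sect. D» AS A KERNEL IDENTITY with (1.103)**.
* §4 **`DHj_single_apply_eq_gradH`**: `(n(S_λ − I)H_j e_q)_{b₀} = R.gradH((b₀₋, λ, μ(b₀)); (q₋, ν(q)))` (p09's `∇H = ∇G·Q*·K`, `∇G = DGk`);
  **`holderBound_DHj_rateFree`**: `∃ δ > 0` (a function of `d, L` only: p09's `rate722` at `a = 1`, `q₀ = q₁ = r_Q = 1`, `γ₁ = γ₀/(4(d+1)+1)`, `KY_d`,
  p19's `δ₀`, `O(1)`) `∀ 0 ≤ α < 1 ∃ C_α ≥ 0 ∀` volumes `(m, K)`, `j + 1 ≤ m + K`, `Λ′`, `w > 0`, `λ`, fine pairs `b₁ = ⟨x, μ⟩`, `b₂ = ⟨x′, μ⟩` with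
  `|x − x′|_∞ ≤ L^j`, unit sites `y`: `Σ_{b : b₋ = y}|(∇_λH_j e_b)_{b₁} − (∇_λH_j e_b)_{b₂}| ≤ C_α·(|x − x′|_∞/L^j)^α·e^{−δ|y(x) − y|_T}` — THE SHAPE OF
  p38's `holderBound_DHj` (whose rate `κ_H(1−α)/(1+α)` degrades as `α ↑ 1`, b05's interpolation reading) WITH THE RATE NOT DEPENDING ON `α`, as the
  print has it for the (1.111) members («δ₂ … depends on d and L only»; [4] p. 35 «O(1) depending on d and α», rate `δ₀`).
HONEST SCOPE / DIVERGENCES. (1) A FACTOR bound: the (1.111)₁ MEMBER `‖ζ∇G_□J‖_α` at an α-free rate follows once p38's composites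
`…B6BlockHolderCompositesV1.holderBound_DHjCtHj_scaling`/`holderBound_DGt_scaling` → `…B6Prop25HolderTwoScaleV1.prop25_ineq111_grad` are fed with
`holderBound_DHj_rateFree` instead of `holderBound_DHj` (their constants are hard-wired; re-threading is that lane's step, asked 2026-08-22T15:54Z) —
NOT done here; until then G-B6-p38-01 stays open at the member level and r03's census clause `ineq111_vec_TS` keeps its `δ₂(1−α)`. (2) Only the
scaling `c = L^j` (the composites' choice); `H_j` itself does not depend on `c`, `a`, `Λ′`, `w`. (3) Carriers, position maps (`y(x) = iterBlockOf j x`,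
unit bonds filed under `b₋`), the torus sup-metric `|·|_T` (`torusSupNorm ∘ rep`), `∇_λ = n(S_λ − I)` exactly as in p22/p38's files 3–14 / H1–H5.
(4) Constants ours (p09/p19's explicit but unevaluated `rate722`, `holderConst`); the print's `δ₂(d, L)`, `O(1)(α)` are quoted as targets only.
(5) No new definition, no new hypothesis, no restatement: every operator and kernel is a landed decl BY NAME.  Value: closes the «kernel bridge»
half of G-B6-p38-01 and makes the printed route for `H_j` («Proposition 1.2 and … (1.99)–(1.101) for Q_jG_jQ_j*») a kernel-checked identity for
the concrete `tsV1`; NOT summit progress.  Unit `lit-balaban-r03` (gen 16, literature-prover-lit-balaban-r03-g16-0), 2026-08-22.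
-/

noncomputable section

open scoped InnerProductSpace BigOperators Matrix
open Finset

namespace Literature.MathematicalPhysics.QuantumFieldTheory.Balaban1983to89.B6HjOneLevelBridgeV1

open LatticeFieldCalculus B5SectBStatements B5Eq117TorusCarriers B6SectADomainsV1 B6SectAOperatorsV1 B6SectAVectorModelV1 B6SectCOperators
  B6SectCTwoScaleV1 B6SectCTwoScaleV1Lattice B5Eq118OneStroke
open BalabanImbrieJaffe1984to88.BIJ85AxialPropagator411 (BondSpace)
open B4Sect5Torus (IsPseudoDist)
open B4TorusKernel.MultiPeriod (torusSupNorm torusSupNorm_nonneg)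
open B3TorusRadialSums (supDist_eq_zero_iff)
open B6LowerBound2153Torus (rep)
open B6CovarianceOperator (inverse_apply comp_inverse)
open B6HjGtOpNormV1 (qpE_whole_eq_zero_iff inner_QE_aE_whole)
open B6GOneLevelV1Bridge (GE_apply_eq_sum_Gk)
open B6Repr2129Operator (Hj_eq_hOp_smul_V1 QGaQ_comp_inverse)
open B6BlockDecayGtV1 (inverse_MjQ_smul_apply)
open B6BlockHolderCalculus (holderBound_of_entry)
open B6BlockDecayHjCovV1 (card_fiber_src_le)
open B6BlockDecayHprimeCovV1 (supDist_cast_eq_torusSupNorm)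
open B6BlockDecayGradFactorsV1 (Dop_comp_apply)
open BalabanImbrieJaffe1984to88.BIJ85Ineq722Proof (Rep103)
open BalabanImbrieJaffe1984to88.BIJ85Ineq722Proof.Rep103 (rate722 rate722_pos M_mul_K)
open BalabanImbrieJaffe1984to88.BIJ85Ineq722ProofPart2 (prop12Hyps_of_ineq110_114 abs_gradH_sub_le holderConst holderConst_nonneg)
open BalabanImbrieJaffe1984to88.BIJ85Ineq722Torus (torusRep torusRep_dS torusRep_dY torusRep_blk stdData torusRep_std_Q_apply
  torusRep_std_Q_mulVec QsStd hyps_torus cutoffHyps_torus KYd supDist_blk_le_one)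
open BalabanImbrieJaffe1984to88.BIJ85Ineq722DeltaA (Gk DGk deltaAData torusHyps_deltaA)
open T4GaugeActionRate (gam0)
open BalabanImbrieJaffe1984to88.BIJ85Prop12AllTori (prop12Printed_allTori_allScales)

/-! ## §1  Entries of linear maps between Euclidean spaces (private bookkeeping) -/

section Plumbing

variable {κ ι : Type*} [Fintype κ] [DecidableEq κ]

/-- `(fx)_i = Σ_k f(e_k)_i·x_k` — a linear map on `ℓ²` is its matrix. [folklore] -/
private theorem apply_eq_sum_single (f : EuclideanSpace ℝ κ →ₗ[ℝ] EuclideanSpace ℝ ι) (x : EuclideanSpace ℝ κ) (i : ι) :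
    f x i = ∑ k, f (EuclideanSpace.single k (1 : ℝ)) i * x k := by
  have hx : x = ∑ k, x k • EuclideanSpace.single k (1 : ℝ) := by
    conv_lhs => rw [← (EuclideanSpace.basisFun κ ℝ).sum_repr x]
    refine Finset.sum_congr rfl fun k _ => ?_
    rw [EuclideanSpace.basisFun_repr, EuclideanSpace.basisFun_apply]
  conv_lhs => rw [hx]
  rw [map_sum]
  show WithLp.ofLp (∑ k, f (x k • EuclideanSpace.single k (1 : ℝ))) i = _
  rw [WithLp.ofLp_sum, Finset.sum_apply]
  refine Finset.sum_congr rfl fun k _ => ?_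
  rw [map_smul]
  show (x k • f (EuclideanSpace.single k 1)) i = _
  rw [PiLp.smul_apply, smul_eq_mul, mul_comm]

/-- the entries of the adjoint are the transposed entries: `(f*e_i)_k = (fe_k)_i`. [folklore] -/
private theorem adjoint_single_apply [Fintype ι] [DecidableEq ι] (f : EuclideanSpace ℝ κ →ₗ[ℝ] EuclideanSpace ℝ ι) (i : ι) (k : κ) :
    LinearMap.adjoint f (EuclideanSpace.single i (1 : ℝ)) k = f (EuclideanSpace.single k (1 : ℝ)) i := by
  have h1 : LinearMap.adjoint f (EuclideanSpace.single i (1 : ℝ)) k =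
      ⟪EuclideanSpace.single k (1 : ℝ), LinearMap.adjoint f (EuclideanSpace.single i (1 : ℝ))⟫_ℝ := by
    rw [EuclideanSpace.inner_single_left]; simp
  rw [h1, LinearMap.adjoint_inner_right, EuclideanSpace.inner_single_right]
  simp

end Plumbing

/-! ## §2  The averaging operators of `tsV1` ARE p09's kernels: `Q_j = η^{d}·QsStdᵀ = Q`, `Q_j* = η^{d}·QsStd = η^d·Q*` -/

section Averaging

variable {P : Params} {c : ℝ} (hc : c ≠ 0) {j : ℕ} (Λ' : Finset (Site P (j + 1))) (w : CIdx j Λ' → ℝ)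
  [DecidableEq (PBond P 0)] [DecidableEq (PBond P j)]

omit [DecidableEq (PBond P 0)] [DecidableEq (PBond P j)] in
/-- **`Q_j` of `tsV1` is p09's kernel `Q` of `torusRep`** (both are the `j`-fold bond average (1.18)): `(Q_jx)_p = Σ_i Q(p, i)·x_i`
(any `G`, `∇G` data — `Q` does not read them). [cite: Balaban1984PropagatorsI, (1.18) p.20] -/
theorem Qv_apply_eq_sum (hj' : j ≤ P.m + P.K) (G : Matrix (Site P 0 × Fin P.d) (Site P 0 × Fin P.d) ℝ)
    (DG : Matrix (Site P 0 × Fin P.d × Fin P.d) (Site P 0 × Fin P.d) ℝ) (x : BondSpace P) (p : PBond P j) :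
    (tsV1 hc Λ' w).Qv x p = ∑ i : Site P 0 × Fin P.d, (torusRep P j (stdData j G DG)).Q (p.src, p.dir) i * x ⟨i.1, i.2⟩ := by
  have h := torusRep_std_Q_mulVec (G := G) (DG := DG) hj' (WithLp.ofLp x) (p.src, p.dir)
  show bondAvgIter j (WithLp.ofLp x) p = _
  rw [show (⟨(p.src, p.dir).1, (p.src, p.dir).2⟩ : PBond P j) = p from rfl] at h
  rw [← h]
  rfl

omit [DecidableEq (PBond P j)] in
/-- **the entries of `Q_j`**: `Q_j(e_{b₀})_p = η^d·QsStd(b₀, p)`. [cite: Balaban1984PropagatorsI, (1.18) p.20] -/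
theorem Qv_single_apply (hj' : j ≤ P.m + P.K) (b₀ : PBond P 0) (p : PBond P j) :
    (tsV1 hc Λ' w).Qv (EuclideanSpace.single b₀ (1 : ℝ)) p = P.eta j ^ P.d * QsStd P j (b₀.src, b₀.dir) (p.src, p.dir) := by
  rw [Qv_apply_eq_sum hc Λ' w hj' 0 0 (EuclideanSpace.single b₀ (1 : ℝ)) p, Finset.sum_eq_single (b₀.src, b₀.dir)]
  · rw [torusRep_std_Q_apply, show (EuclideanSpace.single b₀ (1 : ℝ)) ⟨(b₀.src, b₀.dir).1, (b₀.src, b₀.dir).2⟩ =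
        EuclideanSpace.single b₀ (1 : ℝ) b₀ from rfl, PiLp.single_apply, if_pos rfl, mul_one]
    rfl
  · intro i _ hi
    rw [show (EuclideanSpace.single b₀ (1 : ℝ)) ⟨i.1, i.2⟩ = EuclideanSpace.single b₀ (1 : ℝ) ⟨i.1, i.2⟩ from rfl,
      PiLp.single_apply, if_neg, mul_zero]
    intro h'
    apply hi
    rw [← h']
  · intro h'
    exact absurd (Finset.mem_univ _) h'

/-- **the entries of `Q_j*`** (the `ℓ²`-adjoint of `tsV1`): `(Q_j*y)_{b₀} = η^d·Σ_p QsStd(b₀, p)·y_p` — `η^d` times p09's `Q* = QsStd`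
(the print's `Q*` is the `η^d`-weighted adjoint, (1.21)). [cite: Balaban1984PropagatorsI, (1.18) p.20, (1.21) p.21] -/
theorem adjQv_apply_eq_sum (hj' : j ≤ P.m + P.K) (y : UBond P j) (b₀ : PBond P 0) :
    LinearMap.adjoint (tsV1 hc Λ' w).Qv y b₀ = P.eta j ^ P.d * ∑ p : PBond P j, QsStd P j (b₀.src, b₀.dir) (p.src, p.dir) * y p := by
  rw [apply_eq_sum_single (LinearMap.adjoint (tsV1 hc Λ' w).Qv) y b₀, Finset.mul_sum]
  refine Finset.sum_congr rfl fun p _ => ?_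
  rw [adjoint_single_apply, Qv_single_apply hc Λ' w hj' b₀ p]
  ring

end Averaging

/-! ## §3  `Q_jG′Q_j* = η^d·M`, `(Q_jG′Q_j*)⁻¹ = η^{−d}·K`, and THE BRIDGE `H_j = G′Q_j*(Q_jG′Q_j*)⁻¹ = GQ*(QGQ*)⁻¹ = H` of p09 -/

section Bridge

variable {P : Params} {j : ℕ} (hj : j + 1 ≤ P.m + P.K) (hc : ((P.L : ℝ) ^ j) ≠ 0) (Λ' : Finset (Site P (j + 1)))
  {w : CIdx j Λ' → ℝ} (hw : ∀ i, 0 < w i) {a : ℝ} (ha : 0 < a)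
  [DecidableEq (PBond P 0)] [DecidableEq (PBond P j)]

/-- `η^d > 0`. [folklore] -/
private theorem eta_pow_pos (P : Params) (j : ℕ) : 0 < P.eta j ^ P.d :=
  pow_pos (pow_pos (inv_pos.2 P.cast_L_pos) _) _

/-- `0 < a·n^d` for the weight `w′ = a·(L^j)^d` (`a > 0`). [folklore] -/
private theorem weight_pos (P : Params) (j : ℕ) {a : ℝ} (ha : 0 < a) : 0 < a * ((P.L : ℝ) ^ j) ^ P.d :=
  mul_pos ha (pow_pos (pow_pos P.cast_L_pos _) _)

omit [DecidableEq (PBond P 0)] [DecidableEq (PBond P j)] in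
include hj hw ha in
/-- **`G′ = (M_j + w′Q_j*Q_j)⁻¹` at `w′ = a·n^d`, `c = L^j`, IS p09's kernel `G = Gk` of [4]'s `Δ_a⁻¹`** (p22's `inverse_MjQ_smul_apply` = p21's `G`
of the whole-torus family; r03's `GE_apply_eq_sum_Gk`): `(G′v)_b = Σ_{b′} G_k(b, b′)v_{b′}`. [cite: Balaban1984PropagatorsII, (2.130) p.246; Balaban1984PropagatorsI, (1.71) p.30] -/
theorem Gw_apply_eq_sum (v : BondSpace P) (b : PBond P 0) :
    Ring.inverse ((tsV1 hc Λ' w).Mj + LinearMap.adjoint (tsV1 hc Λ' w).Qv ∘ₗ ((a * ((P.L : ℝ) ^ j) ^ P.d) • LinearMap.id) ∘ₗ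
        (tsV1 hc Λ' w).Qv) v b =
      ∑ b' : PBond P 0, Gk (Nat.le_of_succ_le hj) a (b.src, b.dir) (b'.src, b'.dir) * v b' := by
  rw [inverse_MjQ_smul_apply hc hj Λ' hw (weight_pos P j ha) v]
  exact GE_apply_eq_sum_Gk (Nat.le_of_succ_le hj) (Domains.whole (P := P) j (Nat.le_of_succ_le hj))
    (qpE_whole_eq_zero_iff (Nat.le_of_succ_le hj)) (fun _ => weight_pos P j ha) ha (inner_QE_aE_whole (Nat.le_of_succ_le hj) a) v b

include hj hw ha in
/-- **`Q_jG′Q_j* = η^d·(QGQ*)` entrywise**: `(Q_jG′Q_j*e_q)_p = η^d·M(p, q)` with p09's `M = QGQ*` of `torusRep P j (deltaAData _ a)` (the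
`η^d` is the (1.21) weight by which `tsV1`'s `ℓ²`-adjoint `Q_j*` differs from the print's `Q*`). [cite: Balaban1984PropagatorsI, (1.99)–(1.102) p.34; Balaban1984PropagatorsII, (2.130) p.246] -/
theorem QGQ_single_apply (p q : PBond P j) :
    ((tsV1 hc Λ' w).Qv ∘ₗ
        Ring.inverse ((tsV1 hc Λ' w).Mj + LinearMap.adjoint (tsV1 hc Λ' w).Qv ∘ₗ ((a * ((P.L : ℝ) ^ j) ^ P.d) • LinearMap.id) ∘ₗ
          (tsV1 hc Λ' w).Qv) ∘ₗ LinearMap.adjoint (tsV1 hc Λ' w).Qv) (EuclideanSpace.single q (1 : ℝ)) p =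
      P.eta j ^ P.d * (torusRep P j (deltaAData (Nat.le_of_succ_le hj) a)).M (p.src, p.dir) (q.src, q.dir) := by
  have hj' : j ≤ P.m + P.K := Nat.le_of_succ_le hj
  rw [LinearMap.comp_apply, LinearMap.comp_apply,
    apply_eq_sum_single (tsV1 hc Λ' w).Qv _ p]
  simp_rw [Qv_single_apply hc Λ' w hj', Gw_apply_eq_sum hj hc Λ' hw ha, adjoint_single_apply, Qv_single_apply hc Λ' w hj']
  -- the right-hand side as a double sum over fine bonds
  have hM : (torusRep P j (deltaAData hj' a)).M (p.src, p.dir) (q.src, q.dir) =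
      ∑ b'' : PBond P 0, (∑ b' : PBond P 0, P.eta j ^ P.d * QsStd P j (b'.src, b'.dir) (p.src, p.dir) *
        Gk hj' a (b'.src, b'.dir) (b''.src, b''.dir)) * QsStd P j (b''.src, b''.dir) (q.src, q.dir) := by
    show ∑ x : Site P 0 × Fin P.d, (∑ y : Site P 0 × Fin P.d, P.eta j ^ P.d * QsStd P j y (p.src, p.dir) * Gk hj' a y x) *
        QsStd P j x (q.src, q.dir) = _
    rw [← Equiv.sum_comp (LatticeFieldCalculus.bondEquiv (P := P) (j := 0)).symm]
    refine Finset.sum_congr rfl fun b'' _ => ?_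
    rw [← Equiv.sum_comp (LatticeFieldCalculus.bondEquiv (P := P) (j := 0)).symm]
    rfl
  rw [hM, Finset.mul_sum]
  simp_rw [Finset.mul_sum, Finset.sum_mul, Finset.mul_sum]
  rw [Finset.sum_comm]
  exact Finset.sum_congr rfl fun b'' _ => Finset.sum_congr rfl fun b' _ => by ring

include hj hw ha in
/-- **`(Q_jG′Q_j*)⁻¹ = η^{−d}·(QGQ*)⁻¹` entrywise**: `((Q_jG′Q_j*)⁻¹y)_r = η^{−d}·Σ_p K(r, p)y_p` with p09's `K = M⁻¹` — `M` is invertible by the [7]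
Sect. 5/Combes–Thomas step of p09 (`M_mul_K`, hypothesis-free on the torus through p19's Proposition 1.2 and (1.100) `torusHyps_deltaA`).
[cite: Balaban1984PropagatorsI, (1.102) p.34; Balaban1984PropagatorsII, (2.130) p.246] -/
theorem Ew_apply_eq_sum (y : UBond P j) (r : PBond P j) :
    Ring.inverse ((tsV1 hc Λ' w).Qv ∘ₗ
        Ring.inverse ((tsV1 hc Λ' w).Mj + LinearMap.adjoint (tsV1 hc Λ' w).Qv ∘ₗ ((a * ((P.L : ℝ) ^ j) ^ P.d) • LinearMap.id) ∘ₗ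
          (tsV1 hc Λ' w).Qv) ∘ₗ LinearMap.adjoint (tsV1 hc Λ' w).Qv) y r =
      (P.eta j ^ P.d)⁻¹ * ∑ p : PBond P j, (torusRep P j (deltaAData (Nat.le_of_succ_le hj) a)).K (r.src, r.dir) (p.src, p.dir) * y p := by
  have hj' : j ≤ P.m + P.K := Nat.le_of_succ_le hj
  set R := torusRep P j (deltaAData hj' a) with hR
  set S := (tsV1 hc Λ' w).Qv ∘ₗ
        Ring.inverse ((tsV1 hc Λ' w).Mj + LinearMap.adjoint (tsV1 hc Λ' w).Qv ∘ₗ ((a * ((P.L : ℝ) ^ j) ^ P.d) • LinearMap.id) ∘ₗ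
          (tsV1 hc Λ' w).Qv) ∘ₗ LinearMap.adjoint (tsV1 hc Λ' w).Qv with hS
  set z := Ring.inverse S y with hz
  have hap : ∀ x : UBond P j, x ≠ 0 →
      0 < ⟪x, (((a * ((P.L : ℝ) ^ j) ^ P.d) • LinearMap.id : UBond P j →ₗ[ℝ] UBond P j)) x⟫_ℝ := fun x hx => by
    rw [LinearMap.smul_apply, LinearMap.id_apply, real_inner_smul_right, real_inner_self_eq_norm_sq]
    exact mul_pos (weight_pos P j ha) (by positivity)
  have hSz : S z = y :=
    LinearMap.congr_fun (QGaQ_comp_inverse _ (isLattice Λ' hc hj hw) (positive Λ' hc hj w) hap) y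
  have hη : P.eta j ^ P.d ≠ 0 := (eta_pow_pos P j).ne'
  -- `K·M = 1` (p09: `M·K = 1`, square matrices)
  obtain ⟨δ₀, C, Cα, Cε, Cαε, hδ₀, hC, H⟩ := prop12Printed_allTori_allScales (a := a) P.d P.L ha
  have h12 := prop12Hyps_of_ineq110_114 (R := R) hC.le hδ₀ (H ⟨(P, j), rfl, rfl, hj'⟩)
  have hKM : R.K * R.M = 1 := mul_eq_one_comm.mp (M_mul_K (hyps_torus hj' (torusHyps_deltaA hj' ha)) h12)
  -- `y_p = η^d Σ_q M(p,q) z_q`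
  have hy : ∀ p : PBond P j, y p = P.eta j ^ P.d * ∑ q : PBond P j, R.M (p.src, p.dir) (q.src, q.dir) * z q := by
    intro p
    conv_lhs => rw [← hSz]
    rw [apply_eq_sum_single S z p, Finset.mul_sum]
    refine Finset.sum_congr rfl fun q _ => ?_
    rw [hS, QGQ_single_apply hj hc Λ' hw ha]
    ring
  -- `Σ_p K(r,p) y_p = η^d z_r`
  have key : ∑ p : PBond P j, R.K (r.src, r.dir) (p.src, p.dir) * y p = P.eta j ^ P.d * z r := by
    simp_rw [hy]
    calc ∑ p : PBond P j, R.K (r.src, r.dir) (p.src, p.dir) * (P.eta j ^ P.d * ∑ q : PBond P j, R.M (p.src, p.dir) (q.src, q.dir) * z q)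
        = P.eta j ^ P.d * ∑ q : PBond P j, (∑ p : PBond P j, R.K (r.src, r.dir) (p.src, p.dir) * R.M (p.src, p.dir) (q.src, q.dir)) * z q := by
          rw [Finset.mul_sum]
          simp_rw [Finset.mul_sum, Finset.sum_mul, Finset.mul_sum]
          rw [Finset.sum_comm]
          exact Finset.sum_congr rfl fun q _ => Finset.sum_congr rfl fun p _ => by ring
      _ = P.eta j ^ P.d * ∑ q : PBond P j, (R.K * R.M) (r.src, r.dir) (q.src, q.dir) * z q := by
          congr 1
          refine Finset.sum_congr rfl fun q _ => ?_
          congr 1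
          show _ = ∑ x : Site P j × Fin P.d, R.K (r.src, r.dir) x * R.M x (q.src, q.dir)
          rw [← Equiv.sum_comp (LatticeFieldCalculus.bondEquiv (P := P) (j := j)).symm]
          rfl
      _ = P.eta j ^ P.d * z r := by
          rw [hKM, Finset.sum_eq_single r]
          · rw [Matrix.one_apply_eq, one_mul]
          · intro q _ hq
            rw [Matrix.one_apply_ne, zero_mul]
            intro h'
            have h'' : (LatticeFieldCalculus.bondEquiv (P := P) (j := j)).symm r = (LatticeFieldCalculus.bondEquiv (P := P) (j := j)).symm q := h'
            exact hq ((LatticeFieldCalculus.bondEquiv (P := P) (j := j)).symm.injective h'').symm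
          · intro h'
            exact absurd (Finset.mem_univ _) h'
  rw [key, ← mul_assoc, inv_mul_cancel₀ hη, one_mul]

include hj hw ha in
/-- **THE KERNEL BRIDGE (2.130) ↔ (1.103): the entries of `tsV1`'s `H_j` ARE p09's kernel `H = GQ*(QGQ*)⁻¹` of `torusRep P j (deltaAData _ a)`**
(`G = G_k = Δ_a⁻¹` of [4] (1.71) at the weight `a > 0`; `H_j` itself does not depend on `a` — p22's `Hj_eq_hOp_smul_V1`): `H_j(e_q)_b = H((b₋,μ(b)); (q₋,ν(q)))`.
[cite: Balaban1984PropagatorsII, (2.130) p.246 («Thus this operator coincides with the operator introduced in Sect. D»); Balaban1984PropagatorsI, (1.103) p.34; BalabanImbrieJaffe1985, (7.2.1) p.325] -/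
theorem Hj_single_apply_eq_H (q : PBond P j) (b : PBond P 0) :
    (tsV1 hc Λ' w).Hj (EuclideanSpace.single q (1 : ℝ)) b =
      (torusRep P j (deltaAData (Nat.le_of_succ_le hj) a)).H (b.src, b.dir) (q.src, q.dir) := by
  have hj' : j ≤ P.m + P.K := Nat.le_of_succ_le hj
  have hη : P.eta j ^ P.d ≠ 0 := (eta_pow_pos P j).ne'
  rw [Hj_eq_hOp_smul_V1 hc hj Λ' hw (weight_pos P j ha)]
  rw [show ∀ (G : BondSpace P →ₗ[ℝ] BondSpace P) (Qs : UBond P j →ₗ[ℝ] BondSpace P) (E : UBond P j →ₗ[ℝ] UBond P j),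
      B6SectA.hOp G Qs E = G ∘ₗ Qs ∘ₗ E from fun _ _ _ => rfl, LinearMap.comp_apply, LinearMap.comp_apply,
    Gw_apply_eq_sum hj hc Λ' hw ha]
  simp_rw [adjQv_apply_eq_sum hc Λ' w hj', Ew_apply_eq_sum hj hc Λ' hw ha]
  -- collapse the unit vector: `Σ_{p′} K(p, p′)·e_q(p′) = K(p, q)`
  have hKe : ∀ p : PBond P j, ∑ p' : PBond P j, (torusRep P j (deltaAData hj' a)).K (p.src, p.dir) (p'.src, p'.dir) *
      EuclideanSpace.single q (1 : ℝ) p' = (torusRep P j (deltaAData hj' a)).K (p.src, p.dir) (q.src, q.dir) := by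
    intro p
    rw [Finset.sum_eq_single q]
    · rw [PiLp.single_apply, if_pos rfl, mul_one]
    · intro p' _ hp'
      rw [PiLp.single_apply, if_neg hp', mul_zero]
    · intro h'
      exact absurd (Finset.mem_univ _) h'
  simp_rw [hKe]
  -- `H = G·Q*·K` as a double sum over fine bonds / unit bonds
  have hH : (torusRep P j (deltaAData hj' a)).H (b.src, b.dir) (q.src, q.dir) =
      ∑ p : PBond P j, (∑ b' : PBond P 0, Gk hj' a (b.src, b.dir) (b'.src, b'.dir) * QsStd P j (b'.src, b'.dir) (p.src, p.dir)) *
        (torusRep P j (deltaAData hj' a)).K (p.src, p.dir) (q.src, q.dir) := by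
    show ∑ x : Site P j × Fin P.d, (∑ y : Site P 0 × Fin P.d, Gk hj' a (b.src, b.dir) y * QsStd P j y x) *
        (torusRep P j (deltaAData hj' a)).K x (q.src, q.dir) = _
    rw [← Equiv.sum_comp (LatticeFieldCalculus.bondEquiv (P := P) (j := j)).symm]
    refine Finset.sum_congr rfl fun p _ => ?_
    rw [← Equiv.sum_comp (LatticeFieldCalculus.bondEquiv (P := P) (j := 0)).symm]
    rfl
  rw [hH]
  simp_rw [Finset.mul_sum, Finset.sum_mul]
  rw [Finset.sum_comm]
  refine Finset.sum_congr rfl fun p _ => Finset.sum_congr rfl fun b' _ => ?_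
  rw [show ∀ x y z : ℝ, x * (P.eta j ^ P.d * (y * ((P.eta j ^ P.d)⁻¹ * z))) = x * y * z * (P.eta j ^ P.d * (P.eta j ^ P.d)⁻¹) from
      fun x y z => by ring, mul_inv_cancel₀ hη, mul_one]

end Bridge

/-! ## §4  `∇_λH_j` ↔ p09's `∇H = ∇GQ*(QGQ*)⁻¹`, and the Hölder pair bound of `∇_λH_j` with an `α`-FREE rate ((7.2.2)) -/

section Gradient

variable {P : Params} {j : ℕ} (hj : j + 1 ≤ P.m + P.K) (hc : ((P.L : ℝ) ^ j) ≠ 0) (Λ' : Finset (Site P (j + 1)))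
  {w : CIdx j Λ' → ℝ} (hw : ∀ i, 0 < w i) {a : ℝ} (ha : 0 < a)
  [DecidableEq (PBond P 0)] [DecidableEq (PBond P j)]

include hj hw ha in
/-- **the entries of `∇_λH_j = n(S_λ − I)H_j` (`n = L^j`) ARE p09's gradient kernel `∇H = ∇G·Q*·(QGQ*)⁻¹` (7.2.2)/(1.103)**:
`(∇_λH_j e_q)_{b₀} = ∇H((b₀₋, λ, μ(b₀)); (q₋, ν(q)))`. [cite: BalabanImbrieJaffe1985, (7.2.2) p.325; Balaban1984PropagatorsII, (2.130) p.246] -/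
theorem DHj_single_apply_eq_gradH (lam : Fin P.d) (q : PBond P j) (b₀ : PBond P 0) :
    (((((P.L : ℝ) ^ j) • (onE (LinearMap.funLeft ℝ ℝ (fun b : PBond P 0 => (⟨b.src.shift lam, b.dir⟩ : PBond P 0))) - LinearMap.id) :
        BondSpace P →ₗ[ℝ] BondSpace P)) ∘ₗ (tsV1 hc Λ' w).Hj) (EuclideanSpace.single q (1 : ℝ)) b₀ =
      (torusRep P j (deltaAData (Nat.le_of_succ_le hj) a)).gradH (b₀.src, lam, b₀.dir) (q.src, q.dir) := by
  have hj' : j ≤ P.m + P.K := Nat.le_of_succ_le hj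
  rw [Dop_comp_apply, Hj_single_apply_eq_H hj hc Λ' hw ha, Hj_single_apply_eq_H hj hc Λ' hw ha]
  -- `H = G·(Q*K)`, `∇H = ∇G·(Q*K)` with p09's `∇G = DGk = n(G(x + e_λ, ·) − G(x, ·))`
  have hV : ∀ i : Site P 0 × Fin P.d, (torusRep P j (deltaAData hj' a)).H i (q.src, q.dir) =
      ∑ x : Site P 0 × Fin P.d, Gk hj' a i x *
        ((torusRep P j (deltaAData hj' a)).Qs * (torusRep P j (deltaAData hj' a)).K) x (q.src, q.dir) := by
    intro i
    show ((torusRep P j (deltaAData hj' a)).G * (torusRep P j (deltaAData hj' a)).Qs * (torusRep P j (deltaAData hj' a)).K) i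
      (q.src, q.dir) = _
    rw [Matrix.mul_assoc]
    rfl
  have hDV : (torusRep P j (deltaAData hj' a)).gradH (b₀.src, lam, b₀.dir) (q.src, q.dir) =
      ∑ x : Site P 0 × Fin P.d, DGk hj' a (b₀.src, lam, b₀.dir) x *
        ((torusRep P j (deltaAData hj' a)).Qs * (torusRep P j (deltaAData hj' a)).K) x (q.src, q.dir) := by
    show ((torusRep P j (deltaAData hj' a)).DG * (torusRep P j (deltaAData hj' a)).Qs * (torusRep P j (deltaAData hj' a)).K)
      (b₀.src, lam, b₀.dir) (q.src, q.dir) = _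
    rw [Matrix.mul_assoc]
    rfl
  rw [hV, hV, hDV, ← Finset.sum_sub_distrib, Finset.mul_sum]
  refine Finset.sum_congr rfl fun x _ => ?_
  show ((P.L : ℝ) ^ j) * (Gk hj' a (b₀.src.shift lam, b₀.dir) x *
      ((torusRep P j (deltaAData hj' a)).Qs * (torusRep P j (deltaAData hj' a)).K) x (q.src, q.dir) -
      Gk hj' a (b₀.src, b₀.dir) x * ((torusRep P j (deltaAData hj' a)).Qs * (torusRep P j (deltaAData hj' a)).K) x (q.src, q.dir)) =
    ((P.L : ℝ) ^ j * (Gk hj' a (b₀.src.shift lam, b₀.dir) x - Gk hj' a (b₀.src, b₀.dir) x)) *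
      ((torusRep P j (deltaAData hj' a)).Qs * (torusRep P j (deltaAData hj' a)).K) x (q.src, q.dir)
  ring

end Gradient

section RateFree

open Classical in
/-- **THE HÖLDER (PAIR) BOUND OF `∇_λH_j` WITH A DECAY RATE INDEPENDENT OF `α`** — the shape of p38's `B6BlockHolderHjV1.holderBound_DHj` (unit bonds
over a unit site `y` → a fine pair `b₁ = ⟨x, μ⟩`, `b₂ = ⟨x′, μ⟩`, `|x − x′|_∞ ≤ n = L^j`, anchored at `y(x)`), but now at the scaling `c = L^j`: there is
`δ > 0` depending on `d, L` only and, for every `0 ≤ α < 1`, a `C_α ≥ 0` such that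
`Σ_{b : b₋ = y}|(∇_λH_j e_b)_{b₁} − (∇_λH_j e_b)_{b₂}| ≤ C_α·(|x − x′|_∞/n)^α·e^{−δ|y(x) − y|_T}` — [B6] p. 246 *"their local Hölder norms … have a
uniform exponential decay with a decay rate depending on d only"*, via (2.130) = p09's `H` (§3–§4) and p09's hypothesis-free (7.2.2)
`abs_gradH_sub_le` (*"a consequence of Proposition 1.2 and the representation (1.103)"*: p19's `prop12Printed_allTori_allScales`, (1.100)
`torusHyps_deltaA`, the cut-offs `cutoffHyps_torus`); `δ = rate722(d+1, O(1), δ₀, γ₀/(4(d+1)+1), 1, 1, 1, KY_d)` at [4]'s `a = 1`.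
[cite: Balaban1984PropagatorsII, (2.130) p.246; BalabanImbrieJaffe1985, (7.2.2) p.325; Balaban1984PropagatorsI, (1.111) p.35] -/
theorem holderBound_DHj_rateFree (d L : ℕ) (hd : 1 ≤ d + 1) (hL : Odd L ∧ 1 < L) :
    ∃ δ : ℝ, 0 < δ ∧ ∀ α : ℝ, 0 ≤ α → α < 1 → ∃ C : ℝ, 0 ≤ C ∧ ∀ (m K j : ℕ) (hc : ((L : ℝ) ^ j) ≠ 0)
      (hj : j + 1 ≤ (⟨d + 1, L, m, K, hd, hL⟩ : Params).m + (⟨d + 1, L, m, K, hd, hL⟩ : Params).K)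
      (Λ' : Finset (Site (⟨d + 1, L, m, K, hd, hL⟩ : Params) (j + 1))) (w : CIdx j Λ' → ℝ) (_hw : ∀ i, 0 < w i) (lam : Fin (d + 1))
      (b₁ b₂ : PBond (⟨d + 1, L, m, K, hd, hL⟩ : Params) 0) (_hdir : b₁.dir = b₂.dir) (_hle : supDist b₁.src b₂.src ≤ L ^ j)
      (y : Site (⟨d + 1, L, m, K, hd, hL⟩ : Params) j),
      ∑ b ∈ univ.filter (fun b : PBond (⟨d + 1, L, m, K, hd, hL⟩ : Params) j => b.src = y),
          |(((((L : ℝ) ^ j) • (onE (LinearMap.funLeft ℝ ℝ (fun b : PBond (⟨d + 1, L, m, K, hd, hL⟩ : Params) 0 =>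
              (⟨b.src.shift lam, b.dir⟩ : PBond (⟨d + 1, L, m, K, hd, hL⟩ : Params) 0))) - LinearMap.id) :
            BondSpace (⟨d + 1, L, m, K, hd, hL⟩ : Params) →ₗ[ℝ] BondSpace (⟨d + 1, L, m, K, hd, hL⟩ : Params))) ∘ₗ (tsV1 hc Λ' w).Hj)
              (EuclideanSpace.single b (1 : ℝ)) b₁ -
            (((((L : ℝ) ^ j) • (onE (LinearMap.funLeft ℝ ℝ (fun b : PBond (⟨d + 1, L, m, K, hd, hL⟩ : Params) 0 =>
              (⟨b.src.shift lam, b.dir⟩ : PBond (⟨d + 1, L, m, K, hd, hL⟩ : Params) 0))) - LinearMap.id) :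
            BondSpace (⟨d + 1, L, m, K, hd, hL⟩ : Params) →ₗ[ℝ] BondSpace (⟨d + 1, L, m, K, hd, hL⟩ : Params))) ∘ₗ (tsV1 hc Λ' w).Hj)
              (EuclideanSpace.single b (1 : ℝ)) b₂| ≤
        C * (((supDist b₁.src b₂.src : ℕ) : ℝ) / (L : ℝ) ^ j) ^ α *
          Real.exp (-(δ * torusSupNorm (Mk (⟨d + 1, L, m, K, hd, hL⟩ : Params) j)
            (rep (Mk (⟨d + 1, L, m, K, hd, hL⟩ : Params) j) (iterBlockOf j b₁.src) - rep (Mk (⟨d + 1, L, m, K, hd, hL⟩ : Params) j) y))) := by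
  -- [4] Proposition 1.2 for every torus of dimension `d + 1`, block `L`, at `a = 1` (p19)
  obtain ⟨δ₀, C, Cα, Cε, Cαε, hδ₀, hC, H⟩ := prop12Printed_allTori_allScales (a := (1 : ℝ)) (d + 1) L one_pos
  -- p09's inputs on the (empty-volume) torus `m = K = 0` at scale `0` — only to read off positivity of the constants, which depend on `d, L` only
  have hP₁ : (0 : ℕ) ≤ (⟨d + 1, L, 0, 0, hd, hL⟩ : Params).m + (⟨d + 1, L, 0, 0, hd, hL⟩ : Params).K := Nat.zero_le _
  have h₁ := hyps_torus hP₁ (torusHyps_deltaA hP₁ one_pos)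
  have h12₁ := prop12Hyps_of_ineq110_114 (R := torusRep (⟨d + 1, L, 0, 0, hd, hL⟩ : Params) 0 (deltaAData hP₁ 1)) hC.le hδ₀
    (H ⟨((⟨d + 1, L, 0, 0, hd, hL⟩ : Params), 0), rfl, rfl, hP₁⟩)
  have hcut₁ := cutoffHyps_torus (D := deltaAData hP₁ (1 : ℝ)) hP₁
  refine ⟨rate722 (d + 1) C δ₀ (gam0 (d + 1) / (4 * ((d + 1 : ℕ) : ℝ) + 1)) 1 1 1 (KYd (⟨d + 1, L, 0, 0, hd, hL⟩ : Params)),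
    ?_, fun α hα0 hα1 => ?_⟩
  · have h := rate722_pos h₁ h12₁ (d + 1)
    exact h
  refine ⟨holderConst (d + 1) C δ₀ (gam0 (d + 1) / (4 * ((d + 1 : ℕ) : ℝ) + 1)) 1 1 1 (KYd (⟨d + 1, L, 0, 0, hd, hL⟩ : Params))
      Cα (1 / 4) 4 0 1 α * ((1 * (d + 1) : ℕ) : ℝ), ?_, ?_⟩
  · have h := holderConst_nonneg h₁ h12₁ hcut₁ (d + 1) α
    have h' : 0 ≤ holderConst (d + 1) C δ₀ (gam0 (d + 1) / (4 * ((d + 1 : ℕ) : ℝ) + 1)) 1 1 1 (KYd (⟨d + 1, L, 0, 0, hd, hL⟩ : Params))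
      Cα (1 / 4) 4 0 1 α := h
    positivity
  intro m K j hc hj Λ' w hw lam b₁ b₂ hdir hle y
  have hj' : j ≤ (⟨d + 1, L, m, K, hd, hL⟩ : Params).m + (⟨d + 1, L, m, K, hd, hL⟩ : Params).K := Nat.le_of_succ_le hj
  have hL0 : 0 < L := by have := hL.2; omega
  have hLj : (0 : ℝ) < (L : ℝ) ^ j := by positivity
  -- p09's inputs on THIS torus (same constants)
  have h := hyps_torus hj' (torusHyps_deltaA hj' one_pos)
  have h12 := prop12Hyps_of_ineq110_114 (R := torusRep (⟨d + 1, L, m, K, hd, hL⟩ : Params) j (deltaAData hj' 1)) hC.le hδ₀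
    (H ⟨((⟨d + 1, L, m, K, hd, hL⟩ : Params), j), rfl, rfl, hj'⟩)
  have hcut := cutoffHyps_torus (D := deltaAData hj' (1 : ℝ)) hj'
  have hCα0 : 0 ≤ holderConst (d + 1) C δ₀ (gam0 (d + 1) / (4 * ((d + 1 : ℕ) : ℝ) + 1)) 1 1 1 (KYd (⟨d + 1, L, 0, 0, hd, hL⟩ : Params))
      Cα (1 / 4) 4 0 1 α := holderConst_nonneg h₁ h12₁ hcut₁ (d + 1) α
  have htα : 0 ≤ (((supDist b₁.src b₂.src : ℕ) : ℝ) / (L : ℝ) ^ j) ^ α := Real.rpow_nonneg (by positivity) α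
  set F := ((((L : ℝ) ^ j) • (onE (LinearMap.funLeft ℝ ℝ (fun b : PBond (⟨d + 1, L, m, K, hd, hL⟩ : Params) 0 =>
      (⟨b.src.shift lam, b.dir⟩ : PBond (⟨d + 1, L, m, K, hd, hL⟩ : Params) 0))) - LinearMap.id) :
        BondSpace (⟨d + 1, L, m, K, hd, hL⟩ : Params) →ₗ[ℝ] BondSpace (⟨d + 1, L, m, K, hd, hL⟩ : Params))) ∘ₗ (tsV1 hc Λ' w).Hj with hF
  -- per-entry bound from (7.2.2)
  have hf : ∀ b : PBond (⟨d + 1, L, m, K, hd, hL⟩ : Params) j,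
      |F (EuclideanSpace.single b (1 : ℝ)) b₁ - F (EuclideanSpace.single b (1 : ℝ)) b₂| ≤
        holderConst (d + 1) C δ₀ (gam0 (d + 1) / (4 * ((d + 1 : ℕ) : ℝ) + 1)) 1 1 1 (KYd (⟨d + 1, L, 0, 0, hd, hL⟩ : Params))
            Cα (1 / 4) 4 0 1 α * (((supDist b₁.src b₂.src : ℕ) : ℝ) / (L : ℝ) ^ j) ^ α *
          Real.exp (-(rate722 (d + 1) C δ₀ (gam0 (d + 1) / (4 * ((d + 1 : ℕ) : ℝ) + 1)) 1 1 1 (KYd (⟨d + 1, L, 0, 0, hd, hL⟩ : Params)) *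
            torusSupNorm (Mk (⟨d + 1, L, m, K, hd, hL⟩ : Params) j)
              (rep (Mk (⟨d + 1, L, m, K, hd, hL⟩ : Params) j) (iterBlockOf j b₁.src) -
                rep (Mk (⟨d + 1, L, m, K, hd, hL⟩ : Params) j) b.src))) := by
    intro b
    rw [hF, DHj_single_apply_eq_gradH hj hc Λ' hw one_pos, DHj_single_apply_eq_gradH hj hc Λ' hw one_pos]
    by_cases h0 : supDist b₁.src b₂.src = 0
    · -- `b₁ = b₂`: nothing to prove
      have hb : b₁ = b₂ := by
        have hs : b₁.src = b₂.src := (supDist_eq_zero_iff _ _).1 h0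
        cases b₁; cases b₂
        simp only at hs hdir
        subst hs; subst hdir; rfl
      subst hb
      rw [sub_self, abs_zero]
      positivity
    have hpos : 0 < (torusRep (⟨d + 1, L, m, K, hd, hL⟩ : Params) j (deltaAData hj' 1)).dS b₁.src b₂.src := by
      rw [torusRep_dS]
      exact div_pos (by exact_mod_cast Nat.pos_of_ne_zero h0) hLj
    have hle1 : (torusRep (⟨d + 1, L, m, K, hd, hL⟩ : Params) j (deltaAData hj' 1)).dS b₁.src b₂.src ≤ 1 := by
      rw [torusRep_dS, div_le_one hLj]
      exact_mod_cast hle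
    have hmain := abs_gradH_sub_le h h12 hcut hα0 hα1 (b₁.src, lam, b₁.dir) (b₂.src, lam, b₂.dir) (by rw [hdir]) hpos hle1
      (b.src, b.dir)
    rw [show Fintype.card (torusRep (⟨d + 1, L, m, K, hd, hL⟩ : Params) j (deltaAData hj' 1)).Dir = d + 1 from Fintype.card_fin _]
      at hmain
    dsimp only at hmain
    rw [torusRep_dY, torusRep_blk, torusRep_dS, supDist_cast_eq_torusSupNorm] at hmain
    -- the constants of this torus ARE the `d, L`-constants (definitional unfolding of the torus parameters)
    have hmain' : |(torusRep (⟨d + 1, L, m, K, hd, hL⟩ : Params) j (deltaAData hj' 1)).gradH (b₁.src, lam, b₁.dir) (b.src, b.dir) -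
        (torusRep (⟨d + 1, L, m, K, hd, hL⟩ : Params) j (deltaAData hj' 1)).gradH (b₂.src, lam, b₂.dir) (b.src, b.dir)| ≤
        holderConst (d + 1) C δ₀ (gam0 (d + 1) / (4 * ((d + 1 : ℕ) : ℝ) + 1)) 1 1 1 (KYd (⟨d + 1, L, 0, 0, hd, hL⟩ : Params))
            Cα (1 / 4) 4 0 1 α *
          Real.exp (-(rate722 (d + 1) C δ₀ (gam0 (d + 1) / (4 * ((d + 1 : ℕ) : ℝ) + 1)) 1 1 1 (KYd (⟨d + 1, L, 0, 0, hd, hL⟩ : Params)) *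
            torusSupNorm (Mk (⟨d + 1, L, m, K, hd, hL⟩ : Params) j)
              (rep (Mk (⟨d + 1, L, m, K, hd, hL⟩ : Params) j) (iterBlockOf j b₁.src) -
                rep (Mk (⟨d + 1, L, m, K, hd, hL⟩ : Params) j) b.src))) *
          (((supDist b₁.src b₂.src : ℕ) : ℝ) / (L : ℝ) ^ j) ^ α := hmain
    refine hmain'.trans (le_of_eq ?_)
    ring
  have hsum := holderBound_of_entry (ρ := (fun t t' : Site (⟨d + 1, L, m, K, hd, hL⟩ : Params) j =>
      torusSupNorm (Mk (⟨d + 1, L, m, K, hd, hL⟩ : Params) j)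
        (rep (Mk (⟨d + 1, L, m, K, hd, hL⟩ : Params) j) t - rep (Mk (⟨d + 1, L, m, K, hd, hL⟩ : Params) j) t')))
    F (fun b : PBond (⟨d + 1, L, m, K, hd, hL⟩ : Params) j => b.src) b₁ b₂ (iterBlockOf j b₁.src)
    (mul_nonneg hCα0 htα) (fun y' => (card_fiber_src_le (P := (⟨d + 1, L, m, K, hd, hL⟩ : Params)) y' : _ ≤ 1 * (d + 1))) hf y
  refine hsum.trans (le_of_eq ?_)
  push_cast
  ring

end RateFree

end Literature.MathematicalPhysics.QuantumFieldTheory.Balaban1983to89.B6HjOneLevelBridgeV1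

end
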